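import Literature.Computability.Complexity.RothvossTemplate
import HarnessLib

/-!
# Rothvoss's measures `μ₃`, `μ_k` and the weight matrix `W`: Lemma 7 ⇒ Theorem 1 (Rothvoss 2017, §2–§3.4)

This file has three parts: **Part I** (this docstring) — the measures and `Lemma 7 ⇒ Theorem 1`;
**Part II** — good / small / bad pairs and Lemma 8 (§3.3); **Part III** — re-sampling by template
automorphisms (§3.4). Each part opens with its own `/-! … -/` summary.

# Part I — measures, weight matrix, `Lemma 7 ⇒ Theorem 1`

Continuation of `RothvossTemplate.lean` (encodings `τ : TV k m ≃ Fin n` of a partition with a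
distinguished `3`-matching). For a rectangle `𝓡 = 𝓤 × 𝓜` (cuts × perfect matchings of `K_n`,
`n = rvN k m`) we define, following §3.2 of T. Rothvoss, *The matching polytope has exponential
extension complexity*, J. ACM 64 (2017) 41:

* `pU 𝓤 τ`, `pM 𝓜 τ` — the fractions of `Q₃`-template cuts `U₀` with `τ U₀ ∈ 𝓤`, resp. of
  `Q₃`-template matchings `f` with `τ f τ⁻¹ ∈ 𝓜` (the paper's `p^ex_{U,T}(H)`, `p^ex_{M,T}(H)`), and
  `pUk`, `pMk` likewise for the `Q_k`-families (`p_{U,T}(F)`, `p_{M,T}(F)`);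
* `mu3 𝓤 𝓜 = E_τ[pU · pM]`, `muk 𝓤 𝓜 = E_τ[pUk · pMk]` — the measures `μ₃(𝓡)`, `μ_k(𝓡)` in the
  generated form of §3.2 ("pick a random partition, a random `3`-matching `H`, then randomly
  extend"); uniformity of the generated pair on `Q₃`/`Q_k` is never needed and not proved;
* `Wt U M` — the weight matrix of §2: the `τ`-average of the law of the generated pair `(U, M)`
  minus `1/(k-1)` times its `Q_k`-analogue (the printed `1/|Q₃|`, `-1/((k-1)|Q_k|)`; the `-∞`
  entries on `Q₁` are the forbidden set of `RectangleCorruptionBound.lean`).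

PROVED here: `⟨W, S⟩ = 1` (display (2) of the paper: `inner_Wt_slack`, from the template crossing
counts `3` and `k`), the support of `W` (`Wt_support`), `∑_{𝓤 × 𝓜} W = μ₃(𝓡) - μ_k(𝓡)/(k-1)`
(`sum_rect_Wt`), and hence

* `rectangle_package_of_corruption` — Lemma 7 (`μ₃(𝓡) ≤ κ μ_k(𝓡) + 2^{-δ m}` on rectangles
  without `Q₁`-entries, any `κ ≤ 1/(k-1)`) gives the "(2) + Lemma 6" package of
  `rothvoss_matching_slack_bound_of_rectangle_bound`, and
* `rothvoss_matching_slack_bound_of_corruption` — **Lemma 7 ⇒ Theorem 1** (slack form): the named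
  fact `rothvoss_matching_slack_bound` follows from the corruption inequality for `mu3`/`muk`,
  eventually in odd `m`, for one odd `k > 3`.

What remains for `rothvoss_matching_slack_bound_holds` is exactly Lemma 7 for these `mu3`, `muk`.

## References

* T. Rothvoss, *The matching polytope has exponential extension complexity*, J. ACM 64(6) (2017)
  41:1–41:19, §2 (display (2), Lemma 6, "Lemma 7 ⇒ Lemma 6") and §3.2 [Rothvoss2017].
-/

namespace Literature.Computability.Complexity

open Finset
open Literature.Probability.LatticeModels

namespace Rothvoss

open scoped Classical

variable {k m : ℕ}

/-- Encodings of (partition, `3`-matching): bijections from the template onto the vertex set.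
[cite: Rothvoss2017, §3.2] -/
abbrev Bij (k m : ℕ) : Type := TV k m ≃ Fin (rvN k m)

/-- There is at least one encoding (`k ≥ 3`). [cite: Rothvoss2017, §3.2] -/
theorem card_bij_pos (hk : 3 ≤ k) : 0 < Fintype.card (Bij k m) :=
  Fintype.card_pos_iff.2 ⟨Fintype.equivOfCardEq (by rw [card_TV m hk, Fintype.card_fin])⟩

section Defs

variable (k m)
variable (𝓤 : Finset (Finset (Fin (rvN k m))))
  (𝓜 : Finset ((⊤ : SimpleGraph (Fin (rvN k m))).Subgraph))

/-- `p^ex_{U,T}(H)`: the fraction of `Q₃`-template cuts landing in `𝓤` under `τ`.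
[cite: Rothvoss2017, §3.2] -/
noncomputable def pU (τ : Bij k m) : ℝ :=
  (((cuts₀ k m).filter fun U₀ => U₀.map τ.toEmbedding ∈ 𝓤).card : ℝ) / (cuts₀ k m).card

/-- `p^ex_{M,T}(H)`: the fraction of `Q₃`-template matchings landing in `𝓜` under `τ`.
[cite: Rothvoss2017, §3.2] -/
noncomputable def pM (τ : Bij k m) : ℝ :=
  (((mats₀ k m).filter fun f => toSub τ f ∈ 𝓜).card : ℝ) / (mats₀ k m).card

/-- `p_{U,T}(F)`: the fraction of `Q_k`-template cuts landing in `𝓤` under `τ`.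
[cite: Rothvoss2017, §3.2] -/
noncomputable def pUk (τ : Bij k m) : ℝ :=
  (((cutsk₀ k m).filter fun U₀ => U₀.map τ.toEmbedding ∈ 𝓤).card : ℝ) / (cutsk₀ k m).card

/-- `p_{M,T}(F)`: the fraction of `Q_k`-template matchings landing in `𝓜` under `τ`.
[cite: Rothvoss2017, §3.2] -/
noncomputable def pMk (τ : Bij k m) : ℝ :=
  (((matsk₀ k m).filter fun f => toSub τ f ∈ 𝓜).card : ℝ) / (matsk₀ k m).card

/-- **`μ₃(𝓡) = E_T E_{|H|=3}[p^ex_{M,T}(H) · p^ex_{U,T}(H)]`** (§3.2), as an average over encodings.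
[cite: Rothvoss2017, §3.2] -/
noncomputable def mu3 : ℝ := (∑ τ : Bij k m, pU k m 𝓤 τ * pM k m 𝓜 τ) / Fintype.card (Bij k m)

/-- **`μ_k(𝓡) = E_T E_{|F|=k}[p_{M,T}(F) · p_{U,T}(F)]`** (§3.2), as an average over encodings.
[cite: Rothvoss2017, §3.2] -/
noncomputable def muk : ℝ := (∑ τ : Bij k m, pUk k m 𝓤 τ * pMk k m 𝓜 τ) / Fintype.card (Bij k m)

/-- The law, under uniform `(U₀, f) ∈ C × F`, of the generated pair `(τ U₀, τ f τ⁻¹)`, as a matrix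
on (vertex sets) × (subgraphs). [cite: Rothvoss2017, §3.2] -/
noncomputable def ker (C : Finset (Finset (TV k m))) (F : Finset (TV k m → TV k m)) (τ : Bij k m)
    (U : Finset (Fin (rvN k m))) (M : (⊤ : SimpleGraph (Fin (rvN k m))).Subgraph) : ℝ :=
  (((C ×ˢ F).filter fun p => (p.1.map τ.toEmbedding, toSub τ p.2) = (U, M)).card : ℝ) /
    (C.card * F.card)

/-- **The weight matrix `W`** of Rothvoss 2017, §2 (generated form): `E_τ[law of the Q₃-pair]
- (1/(k-1)) · E_τ[law of the Q_k-pair]`. [cite: Rothvoss2017, §2] -/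
noncomputable def Wt (U : Finset (Fin (rvN k m))) (M : (⊤ : SimpleGraph (Fin (rvN k m))).Subgraph) :
    ℝ :=
  (∑ τ : Bij k m, (ker k m (cuts₀ k m) (mats₀ k m) τ U M -
      ker k m (cutsk₀ k m) (matsk₀ k m) τ U M / ((k : ℝ) - 1))) / Fintype.card (Bij k m)

end Defs

/-! ### Sums of the kernel against test functions -/

/-- Integrating a test function `h` against the kernel over a rectangle `𝓤 × 𝓜`: the average of
`h(τ U₀, τ f τ⁻¹)` over the pairs `(U₀, f)` that land in the rectangle. [folklore] -/
theorem sum_ker_mul (C : Finset (Finset (TV k m))) (F : Finset (TV k m → TV k m)) (τ : Bij k m)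
    (𝓤 : Finset (Finset (Fin (rvN k m)))) (𝓜 : Finset ((⊤ : SimpleGraph (Fin (rvN k m))).Subgraph))
    (h : Finset (Fin (rvN k m)) → (⊤ : SimpleGraph (Fin (rvN k m))).Subgraph → ℝ) :
    ∑ U ∈ 𝓤, ∑ M ∈ 𝓜, ker k m C F τ U M * h U M =
      (∑ p ∈ (C ×ˢ F).filter (fun p => p.1.map τ.toEmbedding ∈ 𝓤 ∧ toSub τ p.2 ∈ 𝓜),
        h (p.1.map τ.toEmbedding) (toSub τ p.2)) / (C.card * F.card) := by
  set g : Finset (TV k m) × (TV k m → TV k m) →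
      Finset (Fin (rvN k m)) × (⊤ : SimpleGraph (Fin (rvN k m))).Subgraph :=
    fun p => (p.1.map τ.toEmbedding, toSub τ p.2) with hg
  have e1 : ∀ U M, ker k m C F τ U M * h U M =
      (∑ p ∈ C ×ˢ F, if g p = (U, M) then h U M else 0) / (C.card * F.card) := by
    intro U M
    simp only [ker, hg]
    rw [div_mul_eq_mul_div, card_filter, Nat.cast_sum, sum_mul]
    congr 1
    refine sum_congr rfl fun p _ => ?_
    split_ifs <;> simp
  simp_rw [e1]
  simp only [← sum_div]
  congr 1
  calc ∑ U ∈ 𝓤, ∑ M ∈ 𝓜, ∑ p ∈ C ×ˢ F, (if g p = (U, M) then h U M else 0)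
      = ∑ U ∈ 𝓤, ∑ p ∈ C ×ˢ F, ∑ M ∈ 𝓜, (if g p = (U, M) then h U M else 0) :=
        sum_congr rfl fun U _ => sum_comm
    _ = ∑ p ∈ C ×ˢ F, ∑ U ∈ 𝓤, ∑ M ∈ 𝓜, (if g p = (U, M) then h U M else 0) := sum_comm
    _ = ∑ p ∈ C ×ˢ F, ∑ q ∈ 𝓤 ×ˢ 𝓜, (if g p = q then h q.1 q.2 else 0) :=
        sum_congr rfl fun p _ =>
          (sum_product 𝓤 𝓜 (fun q => if g p = q then h q.1 q.2 else 0)).symm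
    _ = ∑ p ∈ (C ×ˢ F).filter (fun p => p.1.map τ.toEmbedding ∈ 𝓤 ∧ toSub τ p.2 ∈ 𝓜),
          h (p.1.map τ.toEmbedding) (toSub τ p.2) := by
        rw [sum_filter]
        refine sum_congr rfl fun p _ => ?_
        rw [sum_ite_eq]
        by_cases hc : g p ∈ 𝓤 ×ˢ 𝓜
        · rw [if_pos hc, if_pos (by simpa [hg, mem_product] using hc)]
        · rw [if_neg hc, if_neg (by simpa [hg, mem_product] using hc)]

/-- Total kernel mass of a rectangle: `(#cuts landing in 𝓤) · (#matchings landing in 𝓜)`,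
normalised. [folklore] -/
theorem sum_rect_ker (C : Finset (Finset (TV k m))) (F : Finset (TV k m → TV k m)) (τ : Bij k m)
    (𝓤 : Finset (Finset (Fin (rvN k m)))) (𝓜 : Finset ((⊤ : SimpleGraph (Fin (rvN k m))).Subgraph)) :
    ∑ U ∈ 𝓤, ∑ M ∈ 𝓜, ker k m C F τ U M =
      ((C.filter fun U₀ => U₀.map τ.toEmbedding ∈ 𝓤).card *
        (F.filter fun f => toSub τ f ∈ 𝓜).card : ℝ) / (C.card * F.card) := by
  have h := sum_ker_mul C F τ 𝓤 𝓜 (fun _ _ => 1)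
  simp only [mul_one, sum_const, nsmul_eq_mul] at h
  have hpq : ((C ×ˢ F).filter fun p => p.1.map τ.toEmbedding ∈ 𝓤 ∧ toSub τ p.2 ∈ 𝓜) =
      (C.filter fun U₀ => U₀.map τ.toEmbedding ∈ 𝓤) ×ˢ (F.filter fun f => toSub τ f ∈ 𝓜) := by
    ext p
    simp only [mem_filter, mem_product]
    tauto
  rw [h, hpq, card_product]
  push_cast
  ring

/-- Integrating `h` against the kernel over everything: the plain average of `h(τ U₀, τ f τ⁻¹)`.
[folklore] -/
theorem sum_univ_ker_mul (C : Finset (Finset (TV k m))) (F : Finset (TV k m → TV k m)) (τ : Bij k m)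
    (h : Finset (Fin (rvN k m)) → (⊤ : SimpleGraph (Fin (rvN k m))).Subgraph → ℝ) :
    ∑ U, ∑ M, ker k m C F τ U M * h U M =
      (∑ p ∈ C ×ˢ F, h (p.1.map τ.toEmbedding) (toSub τ p.2)) / (C.card * F.card) := by
  rw [sum_ker_mul C F τ univ univ h]
  congr 1
  exact sum_congr (filter_true_of_mem fun p _ => ⟨mem_univ _, mem_univ _⟩) fun _ _ => rfl

/-- Exchanging the `τ`-average with a double sum against a test function. [folklore] -/
theorem sum_sum_avg_mul {α β γ : Type*} [Fintype α] [Fintype β] (S : Finset γ) (N : ℝ)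
    (a : γ → α → β → ℝ) (s : α → β → ℝ) :
    ∑ x, ∑ y, (∑ t ∈ S, a t x y) / N * s x y = (∑ t ∈ S, ∑ x, ∑ y, a t x y * s x y) / N := by
  simp only [div_mul_eq_mul_div, sum_mul, ← sum_div]
  congr 1
  calc ∑ x, ∑ y, ∑ t ∈ S, a t x y * s x y = ∑ x, ∑ t ∈ S, ∑ y, a t x y * s x y :=
        sum_congr rfl fun x _ => sum_comm
    _ = ∑ t ∈ S, ∑ x, ∑ y, a t x y * s x y := sum_comm

/-- The same exchange for sums over sub-rectangles. [folklore] -/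
theorem sum_sum_avg {α β γ : Type*} (A : Finset α) (B : Finset β) (S : Finset γ) (N : ℝ)
    (a : γ → α → β → ℝ) :
    ∑ x ∈ A, ∑ y ∈ B, (∑ t ∈ S, a t x y) / N = (∑ t ∈ S, ∑ x ∈ A, ∑ y ∈ B, a t x y) / N := by
  simp only [← sum_div]
  congr 1
  calc ∑ x ∈ A, ∑ y ∈ B, ∑ t ∈ S, a t x y = ∑ x ∈ A, ∑ t ∈ S, ∑ y ∈ B, a t x y :=
        sum_congr rfl fun x _ => sum_comm
    _ = ∑ t ∈ S, ∑ x ∈ A, ∑ y ∈ B, a t x y := sum_comm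

/-! ### Crossing numbers of generated pairs -/

/-- A generated `Q₃`-pair crosses in `3` edges. [cite: Rothvoss2017, §3.2] -/
theorem crossing_gen₃ (τ : Bij k m) {p : Finset (TV k m) × (TV k m → TV k m)}
    (hp : p ∈ cuts₀ k m ×ˢ mats₀ k m) : crossing (p.1.map τ.toEmbedding) (toSub τ p.2) = 3 := by
  obtain ⟨hU, hf⟩ := mem_product.1 hp
  obtain ⟨I, -, hI⟩ := mem_image.1 hU
  rw [crossing_xport τ (mem_mats₀.1 hf).1, ← hI, crossing_cut₀_mats₀ I hf]

/-- A generated `Q_k`-pair crosses in `k` edges (`k ≥ 3`). [cite: Rothvoss2017, §3.2] -/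
theorem crossing_genk (hk : 3 ≤ k) (τ : Bij k m) {p : Finset (TV k m) × (TV k m → TV k m)}
    (hp : p ∈ cutsk₀ k m ×ˢ matsk₀ k m) : crossing (p.1.map τ.toEmbedding) (toSub τ p.2) = k := by
  obtain ⟨hU, hf⟩ := mem_product.1 hp
  obtain ⟨I, -, hI⟩ := mem_image.1 hU
  rw [crossing_xport τ (mem_matsk₀.1 hf).1, ← hI, crossing_cutk₀_matsk₀ hk I hf]

/-! ### `⟨W, S⟩ = 1`, the support of `W`, and rectangle sums -/

/-- **Display (2) of Rothvoss 2017: `⟨W, S⟩ = 1`** for the generated weight matrix and the odd-cut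
slack `S_{UM} = |M ∩ δ(U)| - 1` (`k > 3` odd): the `Q₃`-part contributes `3 - 1 = 2`, the `Q_k`-part
`-(k-1)/(k-1) = -1`. [cite: Rothvoss2017, §2 (2)] -/
theorem inner_Wt_slack (hk : Odd k) (hk3 : 3 < k) :
    ∑ U, ∑ M, Wt k m U M * ((crossing U M : ℝ) - 1) = 1 := by
  have hN : (0 : ℝ) < Fintype.card (Bij k m) := by exact_mod_cast card_bij_pos (by omega)
  have hc : (0 : ℝ) < (cuts₀ k m).card := by exact_mod_cast cuts₀_nonempty.card_pos
  have hck : (0 : ℝ) < (cutsk₀ k m).card := by exact_mod_cast cutsk₀_nonempty.card_pos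
  have hm : (0 : ℝ) < (mats₀ k m).card := by exact_mod_cast (mats₀_nonempty hk).card_pos
  have hmk : (0 : ℝ) < (matsk₀ k m).card := by exact_mod_cast (matsk₀_nonempty hk).card_pos
  have hk1 : (0 : ℝ) < (k : ℝ) - 1 := by
    have : (3 : ℝ) < k := by exact_mod_cast hk3
    linarith
  unfold Wt
  rw [sum_sum_avg_mul]
  have hτ : ∀ τ : Bij k m, ∑ U, ∑ M, (ker k m (cuts₀ k m) (mats₀ k m) τ U M -
      ker k m (cutsk₀ k m) (matsk₀ k m) τ U M / ((k : ℝ) - 1)) * ((crossing U M : ℝ) - 1) = 1 := by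
    intro τ
    have e3 := sum_univ_ker_mul (cuts₀ k m) (mats₀ k m) τ (fun U M => (crossing U M : ℝ) - 1)
    have ek := sum_univ_ker_mul (cutsk₀ k m) (matsk₀ k m) τ (fun U M => (crossing U M : ℝ) - 1)
    have s3 : ∑ p ∈ cuts₀ k m ×ˢ mats₀ k m,
        ((crossing (p.1.map τ.toEmbedding) (toSub τ p.2) : ℝ) - 1) =
        (cuts₀ k m).card * (mats₀ k m).card * 2 := by
      rw [sum_congr rfl fun p hp => by rw [crossing_gen₃ τ hp], sum_const, card_product,
        nsmul_eq_mul]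
      push_cast
      ring
    have sk : ∑ p ∈ cutsk₀ k m ×ˢ matsk₀ k m,
        ((crossing (p.1.map τ.toEmbedding) (toSub τ p.2) : ℝ) - 1) =
        (cutsk₀ k m).card * (matsk₀ k m).card * ((k : ℝ) - 1) := by
      rw [sum_congr rfl fun p hp => by rw [crossing_genk (by omega) τ hp], sum_const, card_product,
        nsmul_eq_mul]
      push_cast
      ring
    rw [s3] at e3
    rw [sk] at ek
    have esplit : ∑ U, ∑ M, (ker k m (cuts₀ k m) (mats₀ k m) τ U M -
        ker k m (cutsk₀ k m) (matsk₀ k m) τ U M / ((k : ℝ) - 1)) * ((crossing U M : ℝ) - 1) =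
        ∑ U, ∑ M, ker k m (cuts₀ k m) (mats₀ k m) τ U M * ((crossing U M : ℝ) - 1) -
        (∑ U, ∑ M, ker k m (cutsk₀ k m) (matsk₀ k m) τ U M * ((crossing U M : ℝ) - 1)) /
          ((k : ℝ) - 1) := by
      rw [sum_div, ← sum_sub_distrib]
      refine sum_congr rfl fun U _ => ?_
      rw [sum_div, ← sum_sub_distrib]
      refine sum_congr rfl fun M _ => ?_
      ring
    rw [esplit, e3, ek]
    field_simp
    ring
  simp only [hτ, sum_const, card_univ, nsmul_eq_mul, mul_one]
  exact div_self hN.ne'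

/-- **Support of `W`**: `W_{UM} ≠ 0` only for `t`-cuts `U` and perfect matchings `M` (`m` odd,
`k ≥ 3`). [cite: Rothvoss2017, §2] -/
theorem Wt_support (hk : 3 ≤ k) (hm : Odd m) (U : Finset (Fin (rvN k m)))
    (M : (⊤ : SimpleGraph (Fin (rvN k m))).Subgraph) (hW : Wt k m U M ≠ 0) :
    U.card = rvT k m ∧ M.IsPerfectMatching := by
  unfold Wt at hW
  obtain ⟨τ, -, hτ⟩ := exists_ne_zero_of_sum_ne_zero (fun h => hW (by rw [h, zero_div]))
  have hker : ∀ {C : Finset (Finset (TV k m))} {F : Finset (TV k m → TV k m)},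
      ker k m C F τ U M ≠ 0 → ∃ p ∈ C ×ˢ F, p.1.map τ.toEmbedding = U ∧ toSub τ p.2 = M := by
    intro C F h
    unfold ker at h
    have h' : ((C ×ˢ F).filter fun p => (p.1.map τ.toEmbedding, toSub τ p.2) = (U, M)).card ≠ 0 :=
      fun h0 => h (by rw [h0, Nat.cast_zero, zero_div])
    obtain ⟨p, hp⟩ := card_ne_zero.1 h'
    obtain ⟨hp1, hp2⟩ := mem_filter.1 hp
    exact ⟨p, hp1, (Prod.ext_iff.1 hp2).1, (Prod.ext_iff.1 hp2).2⟩
  by_cases h3 : ker k m (cuts₀ k m) (mats₀ k m) τ U M ≠ 0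
  · obtain ⟨p, hp, rfl, rfl⟩ := hker h3
    obtain ⟨hU, hf⟩ := mem_product.1 hp
    exact ⟨by rw [card_map, card_of_mem_cuts₀ hU],
      toSub_isPerfectMatching τ (mem_mats₀.1 hf).1⟩
  · have hk' : ker k m (cutsk₀ k m) (matsk₀ k m) τ U M ≠ 0 := by
      intro h0
      apply hτ
      rw [not_not.1 h3, h0]
      simp
    obtain ⟨p, hp, rfl, rfl⟩ := hker hk'
    obtain ⟨hU, hf⟩ := mem_product.1 hp
    exact ⟨by rw [card_map, card_of_mem_cutsk₀ hk hm hU],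
      toSub_isPerfectMatching τ (mem_matsk₀.1 hf).1⟩

/-- **Rectangle sums of `W`**: `∑_{(U,M) ∈ 𝓤 × 𝓜} W_{UM} = μ₃(𝓡) - μ_k(𝓡)/(k-1)`.
[cite: Rothvoss2017, §2–§3] -/
theorem sum_rect_Wt (𝓤 : Finset (Finset (Fin (rvN k m))))
    (𝓜 : Finset ((⊤ : SimpleGraph (Fin (rvN k m))).Subgraph)) :
    ∑ U ∈ 𝓤, ∑ M ∈ 𝓜, Wt k m U M = mu3 k m 𝓤 𝓜 - muk k m 𝓤 𝓜 / ((k : ℝ) - 1) := by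
  have hφ : ∀ τ : Bij k m, ∑ U ∈ 𝓤, ∑ M ∈ 𝓜, (ker k m (cuts₀ k m) (mats₀ k m) τ U M -
      ker k m (cutsk₀ k m) (matsk₀ k m) τ U M / ((k : ℝ) - 1)) =
      pU k m 𝓤 τ * pM k m 𝓜 τ - pUk k m 𝓤 τ * pMk k m 𝓜 τ / ((k : ℝ) - 1) := by
    intro τ
    have e3 := sum_rect_ker (cuts₀ k m) (mats₀ k m) τ 𝓤 𝓜
    have ek := sum_rect_ker (cutsk₀ k m) (matsk₀ k m) τ 𝓤 𝓜
    have esplit : ∑ U ∈ 𝓤, ∑ M ∈ 𝓜, (ker k m (cuts₀ k m) (mats₀ k m) τ U M -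
        ker k m (cutsk₀ k m) (matsk₀ k m) τ U M / ((k : ℝ) - 1)) =
        ∑ U ∈ 𝓤, ∑ M ∈ 𝓜, ker k m (cuts₀ k m) (mats₀ k m) τ U M -
          (∑ U ∈ 𝓤, ∑ M ∈ 𝓜, ker k m (cutsk₀ k m) (matsk₀ k m) τ U M) / ((k : ℝ) - 1) := by
      rw [sum_div, ← sum_sub_distrib]
      refine sum_congr rfl fun U _ => ?_
      rw [sum_div, ← sum_sub_distrib]
    rw [esplit, e3, ek]
    simp only [pU, pM, pUk, pMk]
    rw [div_mul_div_comm, div_mul_div_comm]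
  unfold Wt mu3 muk
  rw [sum_sum_avg, sum_congr rfl fun τ _ => hφ τ, sum_sub_distrib, sub_div, ← sum_div,
    div_right_comm]

/-- `μ_k(𝓡) ≥ 0`. [folklore] -/
theorem muk_nonneg (𝓤 : Finset (Finset (Fin (rvN k m))))
    (𝓜 : Finset ((⊤ : SimpleGraph (Fin (rvN k m))).Subgraph)) : 0 ≤ muk k m 𝓤 𝓜 := by
  unfold muk pUk pMk
  positivity

/-! ### Lemma 7 ⇒ (2) + Lemma 6 ⇒ Theorem 1 -/

/-- **"Lemma 7 ⇒ Lemma 6" of Rothvoss 2017 (p. 7), for one `m`.** If every rectangle of `t`-cuts and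
perfect matchings without an entry `|M ∩ δ(U)| = 1` satisfies the corruption inequality
`μ₃(𝓡) ≤ κ μ_k(𝓡) + 2^{-δ m}` with `κ (k-1) ≤ 1` (the paper: `κ = 400/k²`, `k = 501`), then
`W = Wt k m` has `⟨W, S⟩ ≥ 1`, the right support, and `⟨W, 𝓡⟩ ≤ 2^{-δ m}` on all such rectangles.
[cite: Rothvoss2017, §2–§3 (Lem. 6–7)] -/
theorem rectangle_package_of_corruption (hk : Odd k) (hk3 : 3 < k) (hm : Odd m) {κ δ : ℝ}
    (hκ1 : κ * ((k : ℝ) - 1) ≤ 1)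
    (hL7 : ∀ (𝓤 : Finset (Finset (Fin (rvN k m))))
      (𝓜 : Finset ((⊤ : SimpleGraph (Fin (rvN k m))).Subgraph)),
      (∀ U ∈ 𝓤, U.card = rvT k m) → (∀ M ∈ 𝓜, M.IsPerfectMatching) →
      (∀ U ∈ 𝓤, ∀ M ∈ 𝓜, crossing U M ≠ 1) →
        mu3 k m 𝓤 𝓜 ≤ κ * muk k m 𝓤 𝓜 + (2 : ℝ) ^ (-(δ * (m : ℝ)))) :
    ∃ W : Finset (Fin (rvN k m)) → (⊤ : SimpleGraph (Fin (rvN k m))).Subgraph → ℝ,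
      (∀ U M, W U M ≠ 0 → U.card = rvT k m ∧ M.IsPerfectMatching) ∧
      (1 : ℝ) ≤ ∑ U, ∑ M, W U M * ((crossing U M : ℝ) - 1) ∧
      ∀ (𝓤 : Finset (Finset (Fin (rvN k m))))
        (𝓜 : Finset ((⊤ : SimpleGraph (Fin (rvN k m))).Subgraph)),
        (∀ U ∈ 𝓤, U.card = rvT k m) → (∀ M ∈ 𝓜, M.IsPerfectMatching) →
        (∀ U ∈ 𝓤, ∀ M ∈ 𝓜, crossing U M ≠ 1) →
          ∑ U ∈ 𝓤, ∑ M ∈ 𝓜, W U M ≤ (2 : ℝ) ^ (-(δ * (m : ℝ))) := by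
  have hk1 : (0 : ℝ) < (k : ℝ) - 1 := by
    have : (3 : ℝ) < k := by exact_mod_cast hk3
    linarith
  refine ⟨Wt k m, Wt_support (by omega) hm, (inner_Wt_slack hk hk3).symm.le, ?_⟩
  intro 𝓤 𝓜 hU hM h1
  rw [sum_rect_Wt]
  have h := hL7 𝓤 𝓜 hU hM h1
  have hμ := muk_nonneg 𝓤 𝓜 (k := k)
  have hκ : κ ≤ 1 / ((k : ℝ) - 1) := by
    rw [le_div_iff₀ hk1]
    exact hκ1
  have : κ * muk k m 𝓤 𝓜 ≤ muk k m 𝓤 𝓜 / ((k : ℝ) - 1) := by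
    rw [div_eq_mul_one_div, mul_comm (muk k m 𝓤 𝓜)]
    exact mul_le_mul_of_nonneg_right hκ hμ
  linarith

/-- **Rothvoss 2017: Lemma 7 ⇒ Theorem 1 (slack-matrix form), PROVED.** If for one odd `k > 3`,
some `κ` with `κ (k-1) ≤ 1` and some `δ > 0`, the corruption inequality
`μ₃(𝓡) ≤ κ · μ_k(𝓡) + 2^{-δ m}` (Lemma 7 with `κ = 400/k²`) holds for all large odd `m` and all
rectangles `𝓡 = 𝓤 × 𝓜` of `t`-cuts and perfect matchings of `K_{rvN k m}` without an entry
`|M ∩ δ(U)| = 1` — `μ₃`, `μ_k` being the generated measures `mu3`, `muk` of this file — then the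
named fact `rothvoss_matching_slack_bound` holds. [cite: Rothvoss2017, Thm. 1 via Lem. 5–7] -/
theorem rothvoss_matching_slack_bound_of_corruption {k : ℕ} (hk : Odd k) (hk3 : 3 < k) {κ δ : ℝ}
    (hκ1 : κ * ((k : ℝ) - 1) ≤ 1) (hδ : 0 < δ)
    (hL7 : ∀ᶠ m : ℕ in Filter.atTop, Odd m → ∀ (𝓤 : Finset (Finset (Fin (rvN k m))))
      (𝓜 : Finset ((⊤ : SimpleGraph (Fin (rvN k m))).Subgraph)),
      (∀ U ∈ 𝓤, U.card = rvT k m) → (∀ M ∈ 𝓜, M.IsPerfectMatching) →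
      (∀ U ∈ 𝓤, ∀ M ∈ 𝓜, crossing U M ≠ 1) →
        mu3 k m 𝓤 𝓜 ≤ κ * muk k m 𝓤 𝓜 + (2 : ℝ) ^ (-(δ * (m : ℝ)))) :
    rothvoss_matching_slack_bound :=
  rothvoss_matching_slack_bound_of_rectangle_bound ⟨k, hk, hk3, δ, hδ,
    hL7.mono fun _ hm hmo => rectangle_package_of_corruption hk hk3 hmo hκ1 (hm hmo)⟩

end Rothvoss

end Literature.Computability.Complexity

/-!
# Part II — Good, small and bad pairs (Rothvoss 2017, §3.3) and Lemma 8

Continuation of Part I above (encodings `τ` of a partition with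
a distinguished `3`-matching `H`; measures `mu3`, `muk`). Following §3.2–§3.3 of T. Rothvoss,
*The matching polytope has exponential extension complexity*, J. ACM 64 (2017) 41, on the template:

* `coreG` — the perfect matchings `g` of the *core remainder* `(C ∪ D) ∖ V(H) = cr ∪ dr` (as
  self-maps of the template, identity elsewhere); `gStar = {cr x ↔ dr x}` completes `H₀` to the
  template `k`-matching `F₀`;
* `ext₀` — the matchings `M ∈ 𝓜(T)` with `H ⊆ M` (partner maps containing `H₀`, preserving every
  `Aᵢ`, `Bᵢ` and the core remainder), and `matsAll₀ g` — those inducing `g` on the core remainder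
  (`M ∩ E(C ∪ D) = F := H ∪ g`);
* `pH 𝓜 τ = p_{M,T}(H)` and `pAll 𝓜 τ g = p_{M,T}(F)` for `F = H ∪ g`;
* `MGood`, `UGood`, `Good`, `Small` — Definitions 1–2 and "small" of §3.3 (with `p^ex_{U,T}(H) = pU`,
  `p^ex_{U,T}(C) = pUk`, `p^ex_{M,T}(H) = pM`);

and PROVES: `matsk₀ = matsAll₀ gStar` (so `pMk = pAll gStar`), the fibre decomposition
`#{f ∈ mats₀ | P f} = ∑_{g ∈ coreGsep} #{f ∈ matsAll₀ g | P f}` (`card_mats₀_filter_eq_sum`),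
**Lemma 8** (`pM_le_of_MGood`, `le_pM_of_MGood`: `p_{M,T}(H)/(1+ε) ≤ p^ex_{M,T}(H) ≤ (1+ε) p_{M,T}(H)`
for `M`-good pairs), the point-wise inequality of §3.4 for good pairs
`p^ex_M(H) · p^ex_U(H) ≤ (1+ε)³ · p_M(F₀) · p_U(F₀)` (`prod_le_of_Good`), and the trivial bound for
small pairs (`prod_le_of_Small`).

## References

* T. Rothvoss, *The matching polytope has exponential extension complexity*, J. ACM 64(6) (2017)
  41:1–41:19, §3.2–§3.4 (Def. 1–2, Lemma 8) [Rothvoss2017].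
-/

namespace Literature.Computability.Complexity

open Finset
open Literature.Probability.LatticeModels

namespace Rothvoss

open scoped Classical

variable {k m : ℕ}

/-! ### The core remainder and its matchings -/

/-- The core remainder `(C ∪ D) ∖ V(H₀) = cr ∪ dr`. [cite: Rothvoss2017, §3.2] -/
def Lab.isCoreRem : Lab m → Bool
  | .CR => true
  | .DR => true
  | _ => false

variable (k m) in
/-- **Matchings of the core remainder**: fixed-point-free involutions `g` of `cr ∪ dr`, extended by
the identity (the `F ∖ H` for `k`-matchings `F ⊇ H`, `F ⊆ E(C ∪ D)`). [cite: Rothvoss2017, §3.2] -/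
def coreG : Finset (TV k m → TV k m) :=
  univ.filter fun g =>
    (∀ v, (lab v).isCoreRem = true → g v ≠ v ∧ g (g v) = v ∧ (lab (g v)).isCoreRem = true) ∧
    ∀ v, (lab v).isCoreRem = false → g v = v

variable (k m) in
/-- Core-remainder matchings preserving `cr` and `dr` separately (no `C`–`D` edge besides `H₀`:
the core parts of the `Q₃`-template matchings `mats₀`). [cite: Rothvoss2017, §3.2] -/
def coreGsep : Finset (TV k m → TV k m) :=
  (coreG k m).filter fun g => ∀ v, (lab v).isCoreRem = true → lab (g v) = lab v

/-- The template `k`-matching `F₀` minus `H₀`: `cr x ↔ dr x`. [cite: Rothvoss2017, §3.2] -/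
def gStar : TV k m → TV k m
  | .cr x => .dr x
  | .dr x => .cr x
  | v => v

/-- `gStar` is a core-remainder matching. [cite: Rothvoss2017, §3.2] -/
theorem gStar_mem : (gStar : TV k m → TV k m) ∈ coreG k m := by
  refine mem_filter.2 ⟨mem_univ _, fun v hv => ?_, fun v hv => ?_⟩
  · cases v <;> simp [lab, Lab.isCoreRem, gStar] at hv ⊢
  · cases v <;> simp [lab, Lab.isCoreRem, gStar] at hv ⊢

variable (k m) in
/-- **`ext₀`**: the matchings `M ∈ 𝓜(T)` with `H ⊆ M`, on the template: partner maps containing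
`H₀`, preserving every `Aᵢ`, `Bᵢ`, and the core remainder as a set. [cite: Rothvoss2017, §3.2] -/
def ext₀ : Finset (TV k m → TV k m) :=
  univ.filter fun f => (∀ v, f v ≠ v ∧ f (f v) = v) ∧ (∀ j, f (.ch j) = .dh j) ∧
    (∀ v, (lab v).isSmall = true → lab (f v) = lab v) ∧
    ∀ v, (lab v).isCoreRem = true → (lab (f v)).isCoreRem = true

/-- The matchings of `ext₀` inducing `g` on the core remainder (`M ⊇ F = H ∪ g`).
[cite: Rothvoss2017, §3.2] -/
def matsAll₀ (g : TV k m → TV k m) : Finset (TV k m → TV k m) :=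
  (ext₀ k m).filter fun f => ∀ v, (lab v).isCoreRem = true → f v = g v

/-- Membership in `ext₀`, unfolded. [cite: Rothvoss2017, §3.2] -/
theorem mem_ext₀ {f : TV k m → TV k m} : f ∈ ext₀ k m ↔
    (∀ v, f v ≠ v ∧ f (f v) = v) ∧ (∀ j, f (.ch j) = .dh j) ∧
      (∀ v, (lab v).isSmall = true → lab (f v) = lab v) ∧
      ∀ v, (lab v).isCoreRem = true → (lab (f v)).isCoreRem = true := by
  simp [ext₀]

/-- Membership in `matsAll₀ g`, unfolded. [cite: Rothvoss2017, §3.2] -/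
theorem mem_matsAll₀ {f g : TV k m → TV k m} : f ∈ matsAll₀ g ↔
    f ∈ ext₀ k m ∧ ∀ v, (lab v).isCoreRem = true → f v = g v := by
  simp [matsAll₀]

/-- **`matsk₀ = matsAll₀ gStar`**: extending the `k`-matching `F₀ = H₀ ∪ gStar`.
[cite: Rothvoss2017, §3.2] -/
theorem matsk₀_eq_matsAll₀ : matsk₀ k m = matsAll₀ gStar := by
  ext f
  rw [mem_matsk₀, mem_matsAll₀, mem_ext₀]
  constructor
  · rintro ⟨hp, hH, hF, hs⟩
    have hD : ∀ x, f (.dr x) = .cr x := fun x => by rw [← hF x, (hp _).2]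
    refine ⟨⟨hp, hH, hs, fun v hv => ?_⟩, fun v hv => ?_⟩
    · cases v <;> simp [lab, Lab.isCoreRem, hF, hD] at hv ⊢
    · cases v <;> simp [lab, Lab.isCoreRem, hF, hD, gStar] at hv ⊢
  · rintro ⟨⟨hp, hH, hs, -⟩, hg⟩
    exact ⟨hp, hH, fun x => by simpa [gStar] using hg (.cr x) (by simp [lab, Lab.isCoreRem]), hs⟩

/-- `mats₀ ⊆ ext₀`. [cite: Rothvoss2017, §3.2] -/
theorem mats₀_subset_ext₀ : mats₀ k m ⊆ ext₀ k m := by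
  intro f hf
  obtain ⟨hp, hH, hl⟩ := mem_mats₀.1 hf
  refine mem_ext₀.2 ⟨hp, hH, fun v hv => hl v ?_ ?_, fun v hv => ?_⟩
  · cases v <;> simp [lab, Lab.isSmall] at hv ⊢
  · cases v <;> simp [lab, Lab.isSmall] at hv ⊢
  · have h := hl v (by cases v <;> simp [lab, Lab.isCoreRem] at hv ⊢)
      (by cases v <;> simp [lab, Lab.isCoreRem] at hv ⊢)
    rw [h]
    exact hv

/-- Restriction of a template map to the core remainder (identity elsewhere). [folklore] -/
def restrictCore (f : TV k m → TV k m) : TV k m → TV k m :=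
  fun v => if (lab v).isCoreRem = true then f v else v

/-- The core part of a `Q₃`-template matching is a separately-preserving core matching.
[cite: Rothvoss2017, §3.2] -/
theorem restrictCore_mem (f : TV k m → TV k m) (hf : f ∈ mats₀ k m) :
    restrictCore f ∈ coreGsep k m := by
  obtain ⟨hp, -, hl⟩ := mem_mats₀.1 hf
  have hlab : ∀ v, (lab v).isCoreRem = true → lab (f v) = lab v := fun v hv =>
    hl v (by cases v <;> simp [lab, Lab.isCoreRem] at hv ⊢)
      (by cases v <;> simp [lab, Lab.isCoreRem] at hv ⊢)
  refine mem_filter.2 ⟨mem_filter.2 ⟨mem_univ _, fun v hv => ?_, fun v hv => ?_⟩, fun v hv => ?_⟩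
  · have h1 : (lab (f v)).isCoreRem = true := by rw [hlab v hv]; exact hv
    simp only [restrictCore, hv, h1, if_true, and_true, ne_eq]
    exact ⟨(hp v).1, (hp v).2⟩
  · simp [restrictCore, hv]
  · simp only [restrictCore, hv, if_true]
    exact hlab v hv

/-- The fibre of `restrictCore` over `g ∈ coreGsep` inside `mats₀` is `matsAll₀ g`.
[cite: Rothvoss2017, §3.2] -/
theorem mem_mats₀_and_restrictCore_eq {f g : TV k m → TV k m} (hg : g ∈ coreGsep k m) :
    f ∈ mats₀ k m ∧ restrictCore f = g ↔ f ∈ matsAll₀ g := by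
  obtain ⟨hg1, hgsep⟩ := mem_filter.1 hg
  obtain ⟨-, hgcore, hgid⟩ := mem_filter.1 hg1
  constructor
  · rintro ⟨hf, rfl⟩
    exact mem_matsAll₀.2 ⟨mats₀_subset_ext₀ hf, fun v hv => by simp [restrictCore, hv]⟩
  · intro hf
    obtain ⟨hfe, hfg⟩ := mem_matsAll₀.1 hf
    obtain ⟨hp, hH, hs, hc⟩ := mem_ext₀.1 hfe
    refine ⟨mem_mats₀.2 ⟨hp, hH, fun v h1 h2 => ?_⟩, funext fun v => ?_⟩
    · by_cases hv : (lab v).isCoreRem = true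
      · rw [hfg v hv]
        exact hgsep v hv
      · exact hs v (by cases v <;> simp [lab, Lab.isCoreRem, Lab.isSmall] at hv h1 h2 ⊢)
    · by_cases hv : (lab v).isCoreRem = true
      · simp [restrictCore, hv, hfg v hv]
      · simp only [Bool.not_eq_true] at hv
        simp [restrictCore, hv, hgid v hv]

/-- **Fibre decomposition of `mats₀`** along the core part:
`#{f ∈ mats₀ | P f} = ∑_{g ∈ coreGsep} #{f ∈ matsAll₀ g | P f}`. [cite: Rothvoss2017, §3.2] -/
theorem card_mats₀_filter_eq_sum (P : (TV k m → TV k m) → Prop) [DecidablePred P] :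
    ((mats₀ k m).filter P).card = ∑ g ∈ coreGsep k m, ((matsAll₀ g).filter P).card := by
  rw [card_eq_sum_card_fiberwise (f := restrictCore) (t := coreGsep k m)
    (fun f hf => restrictCore_mem f (mem_filter.1 (mem_coe.1 hf)).1)]
  refine sum_congr rfl fun g hg => ?_
  congr 1
  ext f
  simp only [mem_filter]
  constructor
  · rintro ⟨⟨hf, hP⟩, hfg⟩
    exact ⟨(mem_mats₀_and_restrictCore_eq hg).1 ⟨hf, hfg⟩, hP⟩
  · rintro ⟨hf, hP⟩
    have h := (mem_mats₀_and_restrictCore_eq hg).2 hf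
    exact ⟨⟨h.1, hP⟩, h.2⟩

/-- `|mats₀| = ∑_{g ∈ coreGsep} |matsAll₀ g|`. [cite: Rothvoss2017, §3.2] -/
theorem card_mats₀_eq_sum :
    (mats₀ k m).card = ∑ g ∈ coreGsep k m, (matsAll₀ g).card := by
  rw [card_eq_sum_card_fiberwise (f := restrictCore) (t := coreGsep k m)
    (fun f hf => restrictCore_mem f (mem_coe.1 hf))]
  refine sum_congr rfl fun g hg => ?_
  congr 1
  ext f
  simp only [mem_filter]
  exact mem_mats₀_and_restrictCore_eq hg

/-- `coreGsep ⊆ coreG`. [folklore] -/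
theorem coreGsep_subset : coreGsep k m ⊆ coreG k m := filter_subset _ _

/-! ### `p_{M,T}(H)`, `p_{M,T}(F)` and good / small pairs -/

section Defs

variable (k m)
variable (𝓤 : Finset (Finset (Fin (rvN k m))))
  (𝓜 : Finset ((⊤ : SimpleGraph (Fin (rvN k m))).Subgraph))

/-- **`p_{M,T}(H)`**: the fraction of matchings `M ∈ 𝓜_all(T)`, `H ⊆ M`, lying in `𝓜`.
[cite: Rothvoss2017, §3.2] -/
noncomputable def pH (τ : Bij k m) : ℝ :=
  (((ext₀ k m).filter fun f => toSub τ f ∈ 𝓜).card : ℝ) / (ext₀ k m).card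

/-- **`p_{M,T}(F)`** for the `k`-matching `F = H ∪ g` of `C ∪ D`: the fraction of its extensions lying
in `𝓜`. [cite: Rothvoss2017, §3.2] -/
noncomputable def pAll (τ : Bij k m) (g : TV k m → TV k m) : ℝ :=
  (((matsAll₀ g).filter fun f => toSub τ f ∈ 𝓜).card : ℝ) / (matsAll₀ g).card

variable (ε : ℝ)

/-- **`M`-good** (Definition 1 of Rothvoss 2017): `0 < p_{M,T}(H)` and
`p_{M,T}(H)/(1+ε) ≤ p_{M,T}(F) ≤ (1+ε) p_{M,T}(H)` for all `k`-matchings `H ⊆ F ⊆ E(C ∪ D)`.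
[cite: Rothvoss2017, Def. 1] -/
def MGood (τ : Bij k m) :=
  0 < pH k m 𝓜 τ ∧ ∀ g ∈ coreG k m,
    pH k m 𝓜 τ / (1 + ε) ≤ pAll k m 𝓜 τ g ∧ pAll k m 𝓜 τ g ≤ (1 + ε) * pH k m 𝓜 τ

/-- **`U`-good** (Definition 2 of Rothvoss 2017): `0 < p^ex_{U,T}(H)` and
`p^ex_{U,T}(H)/(1+ε) ≤ p^ex_{U,T}(C) ≤ (1+ε) p^ex_{U,T}(H)`. [cite: Rothvoss2017, Def. 2] -/
def UGood (τ : Bij k m) :=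
  0 < pU k m 𝓤 τ ∧ pU k m 𝓤 τ / (1 + ε) ≤ pUk k m 𝓤 τ ∧ pUk k m 𝓤 τ ≤ (1 + ε) * pU k m 𝓤 τ

/-- **Good** = `M`-good and `U`-good. [cite: Rothvoss2017, §3.3] -/
def Good (τ : Bij k m) := MGood k m 𝓜 ε τ ∧ UGood k m 𝓤 ε τ

variable (δ : ℝ)

/-- **Small** pairs: `p^ex_{M,T}(H) ≤ 2^{-δ m}` or `p^ex_{U,T}(H) ≤ 2^{-δ m}`. [cite: Rothvoss2017, §3.3] -/
def Small (τ : Bij k m) :=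
  pM k m 𝓜 τ ≤ (2 : ℝ) ^ (-(δ * (m : ℝ))) ∨ pU k m 𝓤 τ ≤ (2 : ℝ) ^ (-(δ * (m : ℝ)))

end Defs

/-! ### Elementary bounds -/

section Bounds

variable {𝓤 : Finset (Finset (Fin (rvN k m)))}
  {𝓜 : Finset ((⊤ : SimpleGraph (Fin (rvN k m))).Subgraph)} {ε δ : ℝ}

/-- A filtered fraction lies in `[0, 1]`. [folklore] -/
theorem card_filter_div_mem {α : Type*} (s : Finset α) (P : α → Prop) [DecidablePred P] :
    0 ≤ ((s.filter P).card : ℝ) / s.card ∧ ((s.filter P).card : ℝ) / s.card ≤ 1 := by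
  refine ⟨by positivity, ?_⟩
  rcases s.eq_empty_or_nonempty with rfl | hs
  · simp
  · rw [div_le_one (by exact_mod_cast hs.card_pos)]
    exact_mod_cast card_filter_le _ _

/-- `0 ≤ pU ≤ 1`. [folklore] -/
theorem pU_mem (τ : Bij k m) : 0 ≤ pU k m 𝓤 τ ∧ pU k m 𝓤 τ ≤ 1 := by
  unfold pU
  exact card_filter_div_mem _ _

/-- `0 ≤ pM ≤ 1`. [folklore] -/
theorem pM_mem (τ : Bij k m) : 0 ≤ pM k m 𝓜 τ ∧ pM k m 𝓜 τ ≤ 1 := by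
  unfold pM
  exact card_filter_div_mem _ _

/-- `0 ≤ pUk`. [folklore] -/
theorem pUk_nonneg (τ : Bij k m) : 0 ≤ pUk k m 𝓤 τ := by
  unfold pUk
  positivity

/-- `0 ≤ pMk`. [folklore] -/
theorem pMk_nonneg (τ : Bij k m) : 0 ≤ pMk k m 𝓜 τ := by
  unfold pMk
  positivity

/-- `0 ≤ pH`. [folklore] -/
theorem pH_nonneg (τ : Bij k m) : 0 ≤ pH k m 𝓜 τ := by
  unfold pH
  positivity

/-- **Small pairs contribute at most `2^{-δ m}`** (§3.3, the easy estimate).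
[cite: Rothvoss2017, §3.3] -/
theorem prod_le_of_Small {τ : Bij k m} (h : Small k m 𝓤 𝓜 δ τ) :
    pU k m 𝓤 τ * pM k m 𝓜 τ ≤ (2 : ℝ) ^ (-(δ * (m : ℝ))) := by
  rcases h with h | h
  · calc pU k m 𝓤 τ * pM k m 𝓜 τ ≤ 1 * pM k m 𝓜 τ :=
          mul_le_mul_of_nonneg_right (pU_mem τ).2 (pM_mem τ).1
      _ ≤ _ := by rw [one_mul]; exact h
  · calc pU k m 𝓤 τ * pM k m 𝓜 τ ≤ pU k m 𝓤 τ * 1 :=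
          mul_le_mul_of_nonneg_left (pM_mem τ).2 (pU_mem τ).1
      _ ≤ _ := by rw [mul_one]; exact h

/-- `pMk = pAll gStar` (extensions of `F₀ = H₀ ∪ gStar`). [cite: Rothvoss2017, §3.2] -/
theorem pMk_eq_pAll (τ : Bij k m) : pMk k m 𝓜 τ = pAll k m 𝓜 τ gStar := by
  simp only [pMk, pAll, matsk₀_eq_matsAll₀]

/-- **Lemma 8 of Rothvoss 2017, upper half**: for `M`-good `(T, H)`,
`p^ex_{M,T}(H) ≤ (1+ε) p_{M,T}(H)` — `p^ex` is a weighted average of the `p_{M,T}(F)` over the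
`k`-matchings `F ⊇ H` without further `C`–`D` edges. [cite: Rothvoss2017, Lem. 8] -/
theorem pM_le_of_MGood (hk : Odd k) {τ : Bij k m} (h : MGood k m 𝓜 ε τ) :
    pM k m 𝓜 τ ≤ (1 + ε) * pH k m 𝓜 τ := by
  have hA := card_mats₀_filter_eq_sum (k := k) (m := m) (fun f => toSub τ f ∈ 𝓜)
  have hB := card_mats₀_eq_sum (k := k) (m := m)
  have hBpos : (0 : ℝ) < (mats₀ k m).card := by exact_mod_cast (mats₀_nonempty hk).card_pos
  unfold pM
  rw [div_le_iff₀ hBpos, hA, hB]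
  push_cast
  rw [mul_sum]
  refine sum_le_sum fun g hg => ?_
  have hg' := coreGsep_subset hg
  have hup := (h.2 g hg').2
  unfold pAll at hup
  rcases (matsAll₀ g).eq_empty_or_nonempty with h0 | hne
  · simp [h0]
  · have hpos : (0 : ℝ) < (matsAll₀ g).card := by exact_mod_cast hne.card_pos
    rw [div_le_iff₀ hpos] at hup
    linarith

/-- **Lemma 8 of Rothvoss 2017, lower half**: for `M`-good `(T, H)`,
`p_{M,T}(H)/(1+ε) ≤ p^ex_{M,T}(H)`. [cite: Rothvoss2017, Lem. 8] -/
theorem le_pM_of_MGood (hk : Odd k) {τ : Bij k m} (h : MGood k m 𝓜 ε τ) :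
    pH k m 𝓜 τ / (1 + ε) ≤ pM k m 𝓜 τ := by
  have hA := card_mats₀_filter_eq_sum (k := k) (m := m) (fun f => toSub τ f ∈ 𝓜)
  have hB := card_mats₀_eq_sum (k := k) (m := m)
  have hBpos : (0 : ℝ) < (mats₀ k m).card := by exact_mod_cast (mats₀_nonempty hk).card_pos
  unfold pM
  rw [le_div_iff₀ hBpos, hA, hB]
  push_cast
  rw [mul_sum]
  refine sum_le_sum fun g hg => ?_
  have hg' := coreGsep_subset hg
  have hlow := (h.2 g hg').1
  unfold pAll at hlow
  rcases (matsAll₀ g).eq_empty_or_nonempty with h0 | hne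
  · simp [h0]
  · have hpos : (0 : ℝ) < (matsAll₀ g).card := by exact_mod_cast hne.card_pos
    rw [le_div_iff₀ hpos] at hlow
    linarith

/-- **The point-wise inequality of §3.4**: for a good pair,
`p^ex_{U,T}(H) · p^ex_{M,T}(H) ≤ (1+ε)³ · p_{U,T}(F₀) · p_{M,T}(F₀)` (uses Lemma 8, `M`-goodness at
`F₀ = H ∪ gStar`, and `U`-goodness; `ε ≥ 0`). [cite: Rothvoss2017, §3.4] -/
theorem prod_le_of_Good (hk : Odd k) (hε : 0 ≤ ε) {τ : Bij k m} (h : Good k m 𝓤 𝓜 ε τ) :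
    pU k m 𝓤 τ * pM k m 𝓜 τ ≤ (1 + ε) ^ 3 * (pUk k m 𝓤 τ * pMk k m 𝓜 τ) := by
  obtain ⟨hM, hU⟩ := h
  have h1 : pM k m 𝓜 τ ≤ (1 + ε) * pH k m 𝓜 τ := pM_le_of_MGood hk hM
  have h2 : pH k m 𝓜 τ ≤ (1 + ε) * pMk k m 𝓜 τ := by
    have h := (hM.2 gStar gStar_mem).1
    rw [← pMk_eq_pAll, div_le_iff₀ (by linarith)] at h
    linarith
  have h3 : pU k m 𝓤 τ ≤ (1 + ε) * pUk k m 𝓤 τ := by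
    have h := hU.2.1
    rw [div_le_iff₀ (by linarith)] at h
    linarith
  have hM0 := (pM_mem (𝓜 := 𝓜) τ).1
  have hU0 := (pU_mem (𝓤 := 𝓤) τ).1
  have hUk0 := pUk_nonneg (𝓤 := 𝓤) τ
  have hMk0 := pMk_nonneg (𝓜 := 𝓜) τ
  calc pU k m 𝓤 τ * pM k m 𝓜 τ
      ≤ ((1 + ε) * pUk k m 𝓤 τ) * ((1 + ε) * ((1 + ε) * pMk k m 𝓜 τ)) := by
        refine mul_le_mul h3 (h1.trans ?_) hM0 (by positivity)
        exact mul_le_mul_of_nonneg_left h2 (by linarith)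
    _ = (1 + ε) ^ 3 * (pUk k m 𝓤 τ * pMk k m 𝓜 τ) := by ring

end Bounds

end Rothvoss

end Literature.Computability.Complexity

/-!
# Part III — Re-sampling the `3`-matching inside a `k`-matching (§3.4): template automorphisms

Continuation of Parts I–II above. In §3.4 of
T. Rothvoss, *The matching polytope has exponential extension complexity*, J. ACM 64 (2017) 41,
the expectation over a uniform `3`-matching `H ⊆ C × D` is rewritten as an expectation over a
uniform `k`-matching `F` followed by a uniform `H ∈ binom(F, 3)`. In the encoding by bijections
`τ : TV k m ≃ Fin n` this re-sampling is *pre-composition with a template automorphism*: the `k`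
pairs of the template `k`-matching `F₀ = {ch j ↔ dh j} ∪ {cr x ↔ dr x}` are indexed by
`P k = Fin 3 ⊕ Fin (k-3)` (`cVert`, `dVert`), a permutation `π` of `P k` acts on the template by
permuting these pairs simultaneously on the `C`- and the `D`-side (`alpha π`, `alphaEquiv π`), and
`τ ∘ alpha π` encodes the same partition `T`, the same `k`-matching `F = τ F₀`, and the `3`-matching
`H_π = ` the pairs indexed by `π(Fin 3)`.

PROVED here: `alpha` is an action (`alpha_one`, `alpha_mul`) fixing the small blocks; transport
of template matchings along a pre-composed encoding is conjugation (`conj`, `toSub_trans`); the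
`Q_k`-quantities are invariant under re-sampling (`pUk_resample`, `pMk_resample`: `p_{U,T}(F)` and
`p_{M,T}(F)` do not see `H`); the shift of the `τ`-average (`sum_resample`); and the explicit
core-remainder matching `gSwap x₁ x₂` (`cr x₁ ↔ cr x₂`, `dr x₁ ↔ dr x₂`, `cr x ↔ dr x` otherwise)
used in the proof of Lemma 9 (`gSwap_mem`).

## References

* T. Rothvoss, *The matching polytope has exponential extension complexity*, J. ACM 64(6) (2017)
  41:1–41:19, §3.4 [Rothvoss2017].
-/

namespace Literature.Computability.Complexity

open Finset
open Literature.Probability.LatticeModels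

namespace Rothvoss

open scoped Classical

variable {k m : ℕ}

/-! ### Pair indices of `F₀` and the automorphisms `alpha π` -/

/-- Indices of the `k` pairs of the template `k`-matching `F₀`: `inl j` for `{ch j, dh j}` (the
edges of `H₀`), `inr x` for `{cr x, dr x}`. [cite: Rothvoss2017, §3.4] -/
abbrev P (k : ℕ) : Type := Fin 3 ⊕ Fin (k - 3)

/-- The `C`-endpoint of pair `p`. [cite: Rothvoss2017, §3.4] -/
def cVert : P k → TV k m
  | .inl j => .ch j
  | .inr x => .cr x

/-- The `D`-endpoint of pair `p`. [cite: Rothvoss2017, §3.4] -/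
def dVert : P k → TV k m
  | .inl j => .dh j
  | .inr x => .dr x

/-- `cVert` is injective. [folklore] -/
theorem cVert_injective : Function.Injective (cVert : P k → TV k m) := by
  rintro (j | x) (j' | x') h <;> simp [cVert] at h <;> simp [h]

/-- `dVert` is injective. [folklore] -/
theorem dVert_injective : Function.Injective (dVert : P k → TV k m) := by
  rintro (j | x) (j' | x') h <;> simp [dVert] at h <;> simp [h]

/-- A `C`-endpoint is not a `D`-endpoint. [folklore] -/
theorem cVert_ne_dVert (p q : P k) : (cVert p : TV k m) ≠ dVert q := by
  rcases p with j | x <;> rcases q with j' | x' <;> simp [cVert, dVert]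

/-- **The template automorphism `alpha π`**: permute the pairs of `F₀` by `π`, simultaneously on the
`C`-side and on the `D`-side; identity on the blocks `Aᵢ`, `Bᵢ`. [cite: Rothvoss2017, §3.4] -/
def alpha (π : Equiv.Perm (P k)) : TV k m → TV k m
  | .ch j => cVert (π (.inl j))
  | .cr x => cVert (π (.inr x))
  | .dh j => dVert (π (.inl j))
  | .dr x => dVert (π (.inr x))
  | v => v

/-- `alpha π` on `C`-endpoints. [cite: Rothvoss2017, §3.4] -/
@[simp] theorem alpha_cVert (π : Equiv.Perm (P k)) (p : P k) :
    alpha (m := m) π (cVert p) = cVert (π p) := by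
  rcases p with j | x <;> rfl

/-- `alpha π` on `D`-endpoints. [cite: Rothvoss2017, §3.4] -/
@[simp] theorem alpha_dVert (π : Equiv.Perm (P k)) (p : P k) :
    alpha (m := m) π (dVert p) = dVert (π p) := by
  rcases p with j | x <;> rfl

/-- `alpha` fixes block `Aᵢ`. [folklore] -/
@[simp] theorem alpha_a (π : Equiv.Perm (P k)) (i : Fin m) (x : Fin (k - 3)) :
    alpha π (TV.a i x) = TV.a i x := rfl

/-- `alpha` fixes block `Bᵢ`. [folklore] -/
@[simp] theorem alpha_b (π : Equiv.Perm (P k)) (i : Fin m) (x : Fin (2 * (k - 3))) :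
    alpha π (TV.b i x) = TV.b i x := rfl

/-- Every template vertex is a block vertex, a `C`-endpoint or a `D`-endpoint. [folklore] -/
theorem TV.trichotomy (v : TV k m) :
    (∃ i x, v = .a i x) ∨ (∃ i x, v = .b i x) ∨ (∃ p, v = cVert p) ∨ ∃ p, v = dVert p := by
  cases v with
  | a i x => exact Or.inl ⟨i, x, rfl⟩
  | b i x => exact Or.inr (Or.inl ⟨i, x, rfl⟩)
  | ch j => exact Or.inr (Or.inr (Or.inl ⟨.inl j, rfl⟩))
  | cr x => exact Or.inr (Or.inr (Or.inl ⟨.inr x, rfl⟩))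
  | dh j => exact Or.inr (Or.inr (Or.inr ⟨.inl j, rfl⟩))
  | dr x => exact Or.inr (Or.inr (Or.inr ⟨.inr x, rfl⟩))

/-- `alpha 1 = id`. [folklore] -/
theorem alpha_one (v : TV k m) : alpha (1 : Equiv.Perm (P k)) v = v := by
  rcases TV.trichotomy v with ⟨i, x, rfl⟩ | ⟨i, x, rfl⟩ | ⟨p, rfl⟩ | ⟨p, rfl⟩ <;> simp

/-- `alpha (σ * π) = alpha σ ∘ alpha π`. [folklore] -/
theorem alpha_mul (σ π : Equiv.Perm (P k)) (v : TV k m) :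
    alpha (σ * π) v = alpha σ (alpha π v) := by
  rcases TV.trichotomy v with ⟨i, x, rfl⟩ | ⟨i, x, rfl⟩ | ⟨p, rfl⟩ | ⟨p, rfl⟩ <;>
    simp [Equiv.Perm.mul_apply]

/-- `alpha π` as a permutation of the template. [cite: Rothvoss2017, §3.4] -/
def alphaEquiv (π : Equiv.Perm (P k)) : TV k m ≃ TV k m where
  toFun := alpha π
  invFun := alpha π⁻¹
  left_inv v := by rw [← alpha_mul, inv_mul_cancel, alpha_one]
  right_inv v := by rw [← alpha_mul, mul_inv_cancel, alpha_one]

/-- `alphaEquiv π` acts by `alpha π`. [folklore] -/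
@[simp] theorem alphaEquiv_apply (π : Equiv.Perm (P k)) (v : TV k m) :
    alphaEquiv π v = alpha π v := rfl

/-- The inverse of `alphaEquiv π` acts by `alpha π⁻¹`. [folklore] -/
@[simp] theorem alphaEquiv_symm_apply (π : Equiv.Perm (P k)) (v : TV k m) :
    (alphaEquiv π).symm v = alpha π⁻¹ v := rfl

/-- `alpha` does not change block labels of small-block vertices and fixes them. [folklore] -/
theorem alpha_of_isSmall (π : Equiv.Perm (P k)) {v : TV k m} (hv : (lab v).isSmall = true) :
    alpha π v = v := by
  cases v <;> simp [lab, Lab.isSmall] at hv ⊢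

/-- `alpha` preserves membership in `C` (`ch ∪ cr`). [folklore] -/
theorem lab_alpha_cVert (π : Equiv.Perm (P k)) (p : P k) :
    lab (alpha (m := m) π (cVert p)) = Lab.CH ∨ lab (alpha (m := m) π (cVert p)) = Lab.CR := by
  rw [alpha_cVert]
  rcases π p with j | x <;> simp [cVert, lab]

/-! ### Transport along a pre-composed encoding is conjugation -/

/-- Conjugation of a template map by a template permutation. [folklore] -/
def conj (α : TV k m ≃ TV k m) (f : TV k m → TV k m) : TV k m → TV k m :=
  fun v => α (f (α.symm v))

/-- `(α f α⁻¹)(α v) = α (f v)`. [folklore] -/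
@[simp] theorem conj_apply_apply (α : TV k m ≃ TV k m) (f : TV k m → TV k m) (v : TV k m) :
    conj α f (α v) = α (f v) := by
  simp [conj]

/-- Conjugation preserves fixed-point-free involutions. [folklore] -/
theorem conj_spec (α : TV k m ≃ TV k m) {f : TV k m → TV k m}
    (hf : ∀ v, f v ≠ v ∧ f (f v) = v) (v : TV k m) : conj α f v ≠ v ∧ conj α f (conj α f v) = v := by
  refine ⟨fun h => ?_, by simp [conj, (hf _).2]⟩
  have h' := congrArg α.symm h
  simp only [conj, Equiv.symm_apply_apply] at h'
  exact (hf _).1 h'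

/-- `conj α⁻¹` undoes `conj α`. [folklore] -/
theorem conj_symm_conj (α : TV k m ≃ TV k m) (f : TV k m → TV k m) : conj α.symm (conj α f) = f := by
  funext v
  simp [conj]

/-- `conj α` undoes `conj α⁻¹`. [folklore] -/
theorem conj_conj_symm (α : TV k m ≃ TV k m) (f : TV k m → TV k m) : conj α (conj α.symm f) = f := by
  funext v
  simp [conj]

/-- **Transport along `α.trans τ` = transport of the conjugate along `τ`.** [folklore] -/
theorem toSub_trans (α : TV k m ≃ TV k m) (τ : Bij k m) {f : TV k m → TV k m}
    (hf : ∀ v, f v ≠ v ∧ f (f v) = v) : toSub (α.trans τ) f = toSub τ (conj α f) := by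
  have hx : xport (α.trans τ) f = xport τ (conj α f) := by
    funext v
    simp [xport, conj]
  rw [toSub_eq _ hf, toSub_eq _ (conj_spec α hf)]
  simp only [hx]

/-! ### Re-sampling: `τ ↦ alphaEquiv π ⬝ τ` -/

/-- Pre-composition with a template permutation, as a permutation of the encodings. [folklore] -/
def preComp (α : TV k m ≃ TV k m) : Bij k m ≃ Bij k m where
  toFun τ := α.trans τ
  invFun τ := α.symm.trans τ
  left_inv τ := by ext v; simp
  right_inv τ := by ext v; simp

/-- **Shifting the average**: `∑_τ G(α ⬝ τ) = ∑_τ G(τ)`. [folklore] -/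
theorem sum_resample (α : TV k m ≃ TV k m) (G : Bij k m → ℝ) :
    ∑ τ : Bij k m, G (α.trans τ) = ∑ τ : Bij k m, G τ :=
  Equiv.sum_comp (preComp α) G

/-- `C`-endpoints lie in every `Q_k`-template cut. [folklore] -/
@[simp] theorem cutkMem_cVert (I : Finset (Fin m)) (q : P k) : cutkMem I (cVert q : TV k m) = true := by
  rcases q with j | x <;> rfl

/-- `D`-endpoints lie in no `Q_k`-template cut. [folklore] -/
@[simp] theorem cutkMem_dVert (I : Finset (Fin m)) (q : P k) : cutkMem I (dVert q : TV k m) = false := by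
  rcases q with j | x <;> rfl

/-- Re-sampling does not move `Q_k`-template cuts. [cite: Rothvoss2017, §3.4] -/
theorem cutk₀_map_alpha (π : Equiv.Perm (P k)) (I : Finset (Fin m)) :
    (cutk₀ I : Finset (TV k m)).map (alphaEquiv π).toEmbedding = cutk₀ I := by
  ext v
  rw [mem_map_equiv, mem_cutk₀, mem_cutk₀, alphaEquiv_symm_apply]
  rcases TV.trichotomy v with ⟨i, x, rfl⟩ | ⟨i, x, rfl⟩ | ⟨p, rfl⟩ | ⟨p, rfl⟩
  · simp
  · simp
  · rw [alpha_cVert, cutkMem_cVert, cutkMem_cVert]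
  · rw [alpha_dVert, cutkMem_dVert, cutkMem_dVert]

/-- **`p_{U,T}(F)` is invariant under re-sampling `H` inside `F`.** [cite: Rothvoss2017, §3.4] -/
theorem pUk_resample (𝓤 : Finset (Finset (Fin (rvN k m)))) (π : Equiv.Perm (P k)) (τ : Bij k m) :
    pUk k m 𝓤 ((alphaEquiv π).trans τ) = pUk k m 𝓤 τ := by
  unfold pUk
  have h : ((cutsk₀ k m).filter fun U₀ => U₀.map ((alphaEquiv π).trans τ).toEmbedding ∈ 𝓤) =
      (cutsk₀ k m).filter fun U₀ => U₀.map τ.toEmbedding ∈ 𝓤 := by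
    refine filter_congr fun U₀ hU₀ => ?_
    obtain ⟨I, -, rfl⟩ := mem_image.1 hU₀
    rw [Equiv.trans_toEmbedding, ← map_map, cutk₀_map_alpha]
  rw [h]

/-- Conjugation by `alpha π` preserves the `Q_k`-template matchings. [cite: Rothvoss2017, §3.4] -/
theorem conj_alpha_mem_matsk₀ (π : Equiv.Perm (P k)) {f : TV k m → TV k m} (hf : f ∈ matsk₀ k m) :
    conj (alphaEquiv π) f ∈ matsk₀ k m := by
  obtain ⟨hp, hH, hF, hs⟩ := mem_matsk₀.1 hf
  have hpair : ∀ p : P k, f (cVert p) = (dVert p : TV k m) := by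
    rintro (j | x)
    · exact hH j
    · exact hF x
  refine mem_matsk₀.2 ⟨conj_spec _ hp, fun j => ?_, fun x => ?_, fun v hv => ?_⟩
  · show alpha π (f (alpha π⁻¹ (cVert (.inl j)))) = dVert (.inl j)
    rw [alpha_cVert, hpair, alpha_dVert]
    simp
  · show alpha π (f (alpha π⁻¹ (cVert (.inr x)))) = dVert (.inr x)
    rw [alpha_cVert, hpair, alpha_dVert]
    simp
  · show lab (alpha π (f (alpha π⁻¹ v))) = lab v
    have h1 : alpha π⁻¹ v = v := alpha_of_isSmall _ hv
    rw [h1]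
    have h2 : (lab (f v)).isSmall = true := by rw [hs v hv]; exact hv
    rw [alpha_of_isSmall _ h2, hs v hv]

/-- **`p_{M,T}(F)` is invariant under re-sampling `H` inside `F`.** [cite: Rothvoss2017, §3.4] -/
theorem pMk_resample (𝓜 : Finset ((⊤ : SimpleGraph (Fin (rvN k m))).Subgraph))
    (π : Equiv.Perm (P k)) (τ : Bij k m) :
    pMk k m 𝓜 ((alphaEquiv π).trans τ) = pMk k m 𝓜 τ := by
  unfold pMk
  congr 2
  refine card_bij' (fun f _ => conj (alphaEquiv π) f) (fun f _ => conj (alphaEquiv π).symm f)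
    (fun f hf => ?_) (fun f hf => ?_) (fun f _ => conj_symm_conj _ _) (fun f _ => conj_conj_symm _ _)
  · obtain ⟨hf, hM⟩ := mem_filter.1 hf
    refine mem_filter.2 ⟨conj_alpha_mem_matsk₀ π hf, ?_⟩
    rwa [← toSub_trans _ _ (mem_matsk₀.1 hf).1]
  · obtain ⟨hf, hM⟩ := mem_filter.1 hf
    have hmem : conj (alphaEquiv π).symm f ∈ matsk₀ k m := by
      have h := conj_alpha_mem_matsk₀ π⁻¹ hf
      have e : (alphaEquiv π⁻¹ : TV k m ≃ TV k m) = (alphaEquiv π).symm := by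
        ext v
        simp
      rwa [e] at h
    refine mem_filter.2 ⟨hmem, ?_⟩
    rw [toSub_trans _ _ (mem_matsk₀.1 hmem).1, conj_conj_symm]
    exact hM

/-! ### The core-remainder matching of Lemma 9 -/

/-- **`gSwap x₁ x₂`**: the perfect matching `{cr x₁ ↔ cr x₂, dr x₁ ↔ dr x₂} ∪ {cr x ↔ dr x : x ≠ x₁, x₂}`
of the core remainder (extends `H₀* ∪ {(u, v)}` in the proof of Lemma 9, `u = cr x₁`, `v = cr x₂`).
[cite: Rothvoss2017, Lem. 9] -/
def gSwap (x₁ x₂ : Fin (k - 3)) : TV k m → TV k m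
  | .cr x => if x = x₁ then .cr x₂ else if x = x₂ then .cr x₁ else .dr x
  | .dr x => if x = x₁ then .dr x₂ else if x = x₂ then .dr x₁ else .cr x
  | v => v

/-- `gSwap x₁ x₂ (cr x₁) = cr x₂`. [folklore] -/
@[simp] theorem gSwap_cr_left (x₁ x₂ : Fin (k - 3)) : gSwap (m := m) x₁ x₂ (.cr x₁) = .cr x₂ := by
  simp [gSwap]

/-- `gSwap x₁ x₂ (cr x₂) = cr x₁`. [folklore] -/
@[simp] theorem gSwap_cr_right (x₁ x₂ : Fin (k - 3)) : gSwap (m := m) x₁ x₂ (.cr x₂) = .cr x₁ := by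
  simp only [gSwap]
  split_ifs with h <;> simp [h]

/-- `gSwap x₁ x₂` is a core-remainder matching for `x₁ ≠ x₂`. [cite: Rothvoss2017, Lem. 9] -/
theorem gSwap_mem {x₁ x₂ : Fin (k - 3)} (hx : x₁ ≠ x₂) : (gSwap x₁ x₂ : TV k m → TV k m) ∈ coreG k m := by
  have hx' : x₂ ≠ x₁ := fun h => hx h.symm
  refine mem_filter.2 ⟨mem_univ _, fun v hv => ?_, fun v hv => ?_⟩
  · cases v with
    | cr x =>
      by_cases h1 : x = x₁
      · subst h1
        simp [gSwap, hx', lab, Lab.isCoreRem]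
      · by_cases h2 : x = x₂
        · subst h2
          simp [gSwap, h1, hx, lab, Lab.isCoreRem]
        · simp [gSwap, h1, h2, lab, Lab.isCoreRem]
    | dr x =>
      by_cases h1 : x = x₁
      · subst h1
        simp [gSwap, hx', lab, Lab.isCoreRem]
      · by_cases h2 : x = x₂
        · subst h2
          simp [gSwap, h1, hx, lab, Lab.isCoreRem]
        · simp [gSwap, h1, h2, lab, Lab.isCoreRem]
    | _ => simp [lab, Lab.isCoreRem] at hv
  · cases v <;> simp [lab, Lab.isCoreRem, gSwap] at hv ⊢

end Rothvoss

end Literature.Computability.Complexity
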